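import Mathlib
import HarnessLib
import Literature.Combinatorics.SimpleGraph.LasserreStableBound
import Literature.Combinatorics.SimpleGraph.LasserreLevelOne
import Literature.Combinatorics.SimpleGraph.LasserreCliqueCover
import Literature.Combinatorics.SimpleGraph.LovaszThetaComplement
import Summits.PneNP.PneNP.Theses.RamseyUncertifiable

/-!
# Route `RamseyUncertifiable`, item `SosUncertainty` (stmt-PneNP-9815) — the conditioning recursion
# and monotonicity of `ϑ` under induced subgraphs

Two certification-side tools for Laurent's `las_t = lasserreStableBound`, landed here (prover) from
the standing adversary file of the crux (`Summits/PneNP/PneNP/Cruxes/SosUncertainty/Disproof.lean`,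
sections (f) and (g), refuter-cdisprove-stmt-PneNP-9815-0, 2026-08-15/16 — a refuter may land only
`¬`-theorems under `Theorems/`, so these positive lemmas travelled as item evidence; the proofs below
are that file's, re-keyed to Mathlib's induced subgraphs `G.induce (Gᶜ.neighborSet u)`):

* `isLasserreFeasible_condVec` — CONDITIONING a level-`(t+1)` feasible moment vector `y` on `x_u = 1`
  (`z_S = y_{S ∪ {u}} / y_u`) gives a level-`t` feasible vector of the link complement
  `G[N̄(u)] = G.induce (Gᶜ.neighborSet u)`;
* `sum_pair_le_mul` — hence `Σ_v y_{uv} ≤ y_u (1 + las_t(G[N̄ u]))`;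
* `lasserreStableBound_succ_le_one_add` — the **conditioning recursion**
  `las_{t+1}(G) ≤ 1 + M` whenever `las_t(G[N̄ u]) ≤ M` for all `u` (`t ≥ 1`; with the level-1
  inequality `(Σ_v y_v)² ≤ Σ_{u,v} y_{uv}`, tree `sq_sum_le_sum_sum_pair`), and its level-2 case
  `lasserreStableBound_two_le_one_add` (`las₂(G) ≤ 1 + max_u ϑ(G[N̄ u])`);
* `lovaszTheta_comap_le` — `ϑ` is MONOTONE under induced subgraphs along injections (zero-padding of
  a feasible matrix), with corollaries `lovaszTheta_le_of_embedding`, `lovaszTheta_eq_of_iso`,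
  `lovaszTheta_induce_mono`, `lovaszTheta_induce_congr`;
* `card_le_linkTheta_mul` — Lovász's uncertainty principle on a common part:
  `|X| ≤ ϑ(G[A]) · ϑ(Gᶜ[B])` whenever `X ⊆ A ∩ B` (Cor. 2 on `G[X]` + monotonicity) — the reason the
  conditioning certificate cannot make both sides small at once (quantified at every level in
  `RamseyUncertifiableSosUncertaintyConditioningUncertainty.lean`).

References: M. Laurent, Math. Program. 109 (2007) §3.1 (program (22)); L. Lovász, IEEE Trans. Inform.
Theory 25 (1979) Cor. 2; the recursion is the standard "conditioning" of pseudo-expectations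
[folklore].
-/

-- the Theorems namespace `Summit.PneNP.PneNP.Theorems` is prescribed by the tree layout
set_option linter.dupNamespace false

namespace Summit.PneNP.PneNP.Theorems.SosUncertainty

open Literature.Combinatorics.SimpleGraph Finset Matrix

/-! ### (f) The conditioning recursion (after refuter-cdisprove-stmt-PneNP-9815 Disproof (f)) -/

section Conditioning

variable {V : Type} [Fintype V] [DecidableEq V] {G : SimpleGraph V} [DecidableRel G.Adj]

omit [Fintype V] [DecidableRel G.Adj] in
/-- `insert u` commutes with the union of images of link subsets. [folklore] -/
theorem insert_map_union (u : V) (I J : Finset (Gᶜ.neighborSet u)) :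
    insert u ((I ∪ J).map (Function.Embedding.subtype _)) =
      insert u (I.map (Function.Embedding.subtype _)) ∪
        insert u (J.map (Function.Embedding.subtype _)) := by
  rw [Finset.map_union]
  ext x
  simp only [Finset.mem_insert, Finset.mem_union]
  tauto

omit [DecidableRel G.Adj] in
/-- **Conditioning on `x_u = 1`.** If `y` is level-`(t+1)` feasible for `G` (`t ≥ 1`) and `y_u > 0`,
then `z_S := y_{S ∪ {u}} / y_u` (`S` a set of non-neighbours of `u`) is level-`t` feasible for the link
complement `G[N̄(u)] = G.induce (Gᶜ.neighborSet u)`: `M_t(z)` is `y_u⁻¹` times a principal submatrix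
of `M_{t+1}(y)`, and the edge condition is `y_{uab} = 0` for an edge `ab` (a non-stable set of size
`3 ≤ 2(t+1)`). [folklore; Disproof (f) `isLasserreFeasible_condVec`] -/
theorem isLasserreFeasible_condVec {t : ℕ} (ht : 1 ≤ t) {y : Finset V → ℝ}
    (hy : IsLasserreFeasible G (t + 1) y) (u : V) (hu : 0 < y {u}) :
    IsLasserreFeasible (G.induce (Gᶜ.neighborSet u)) t
      (fun S : Finset (Gᶜ.neighborSet u) =>
        y (insert u (S.map (Function.Embedding.subtype _))) / y {u}) := by
  have hu0 : y {u} ≠ 0 := hu.ne'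
  refine ⟨?_, ?_, ?_⟩
  · simp [hu0]
  · intro a b hab
    have hab' : G.Adj a.1 b.1 := hab
    have hne : a.1 ≠ b.1 := hab'.ne
    simp only [Finset.map_insert, Finset.map_singleton, Function.Embedding.coe_subtype,
      div_eq_zero_iff]
    left
    apply hy.apply_eq_zero_of_not_isIndepSet
    · calc (insert u ({a.1, b.1} : Finset V)).card ≤ ({a.1, b.1} : Finset V).card + 1 :=
            Finset.card_insert_le _ _
        _ = 2 + 1 := by rw [card_pair hne]
        _ ≤ 2 * (t + 1) := by omega
    · intro hind
      exact hind (by simp) (by simp) hne hab'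
  · let f : {S : Finset (Gᶜ.neighborSet u) // S.card ≤ t} → {S : Finset V // S.card ≤ t + 1} :=
      fun I => ⟨insert u (I.1.map (Function.Embedding.subtype _)), by
        calc (insert u (I.1.map (Function.Embedding.subtype _))).card
            ≤ (I.1.map (Function.Embedding.subtype _)).card + 1 := Finset.card_insert_le _ _
          _ = I.1.card + 1 := by rw [Finset.card_map]
          _ ≤ t + 1 := by have := I.2; omega⟩
    have hM : momentMatrix t (fun S : Finset (Gᶜ.neighborSet u) =>
          y (insert u (S.map (Function.Embedding.subtype _))) / y {u}) =
        (y {u})⁻¹ • (momentMatrix (t + 1) y).submatrix f f := by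
      ext I J
      simp only [momentMatrix_apply, Matrix.smul_apply, submatrix_apply, f, smul_eq_mul,
        div_eq_inv_mul, insert_map_union]
    rw [hM]
    exact (hy.posSemidef.submatrix f).smul (inv_nonneg.2 hu.le)

/-- **Row sums of the pair moments are controlled by the link bound**:
`Σ_v y_{uv} ≤ y_u · (1 + las_t(G[N̄(u)]))` for level-`(t+1)` feasible `y`, `t ≥ 1`.
[folklore; Disproof (f) `sum_pair_le_mul`] -/
theorem sum_pair_le_mul {t : ℕ} (ht : 1 ≤ t) {y : Finset V → ℝ}
    (hy : IsLasserreFeasible G (t + 1) y) (u : V) :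
    ∑ v, y {u, v} ≤ y {u} * (1 + lasserreStableBound (G.induce (Gᶜ.neighborSet u)) t) := by
  have hcard1 : ∀ w : V, ({w} : Finset V).card ≤ t + 1 := fun w => by
    rw [card_singleton]; omega
  -- split `Σ_v` into `v = u`, `v ∼ u` (zero terms) and `v ∈ N̄(u)`
  have hsplit : ∑ v, y {u, v} = y {u} + ∑ v ∈ Gᶜ.neighborFinset u, y {u, v} := by
    rw [← Finset.sum_filter_add_sum_filter_not univ (fun v => v = u)]
    congr 1
    · rw [Finset.filter_eq' univ u, if_pos (mem_univ u), sum_singleton, pair_eq_singleton]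
    · rw [← Finset.sum_filter_add_sum_filter_not (univ.filter fun v => ¬ v = u) (fun v => G.Adj u v)]
      have h0 : ∑ v ∈ (univ.filter fun v => ¬ v = u).filter (fun v => G.Adj u v), y {u, v} = 0 :=
        Finset.sum_eq_zero fun v hv => hy.pair_eq_zero (by simp only [mem_filter] at hv; exact hv.2)
      rw [h0, zero_add, Finset.filter_filter]
      refine Finset.sum_congr ?_ fun _ _ => rfl
      ext v
      simp only [mem_filter, mem_univ, true_and, SimpleGraph.mem_neighborFinset,
        SimpleGraph.compl_adj, ne_eq]
      tauto
  have hlas0 : 0 ≤ lasserreStableBound (G.induce (Gᶜ.neighborSet u)) t :=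
    lasserreStableBound_nonneg _ t ht
  rcases (hy.apply_nonneg (hcard1 u)).eq_or_lt with h0 | hpos
  · -- `y_u = 0`: every pair moment through `u` vanishes
    have hz : ∀ v, y {u, v} = 0 := fun v => by
      have := hy.apply_union_eq_zero (I := {u}) (J := {v}) (hcard1 u) (hcard1 v) h0.symm
      rwa [singleton_union] at this
    simp [hz, ← h0]
  · rw [hsplit]
    have hfeas := isLasserreFeasible_condVec ht hy u hpos
    have hval := hfeas.sum_singleton_le_lasserreStableBound ht
    have hterm : ∀ a : Gᶜ.neighborSet u,
        y (insert u (({a} : Finset (Gᶜ.neighborSet u)).map (Function.Embedding.subtype _))) / y {u}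
          = (y {u})⁻¹ * y {u, a.1} := fun a => by
      simp [div_eq_inv_mul]
    simp only [hterm, ← Finset.mul_sum] at hval
    rw [Finset.sum_subtype (Gᶜ.neighborFinset u) (p := fun v => v ∈ Gᶜ.neighborSet u)
      (fun v => by simp)]
    rw [inv_mul_le_iff₀ hpos] at hval
    linarith

/-- **The conditioning recursion**: `las_{t+1}(G) ≤ 1 + M` whenever every link complement has
`las_t(G[N̄(u)]) ≤ M` (`t ≥ 1`, `G` nonempty). From `(Σ_v y_v)² ≤ Σ_{u,v} y_{uv}` (level 1, tree
`sq_sum_le_sum_sum_pair`) and `sum_pair_le_mul`. Iterated it bounds `las_s(G)` by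
`(s − 1) + max_S ϑ(G[N̄(S)])` over stable `(s−1)`-sets — the conditioning certificate.
[folklore; Disproof (f) `lasserreStableBound_succ_le_one_add`] -/
theorem lasserreStableBound_succ_le_one_add [Nonempty V] {t : ℕ} (ht : 1 ≤ t) {M : ℝ}
    (hM : ∀ u : V, lasserreStableBound (G.induce (Gᶜ.neighborSet u)) t ≤ M) :
    lasserreStableBound G (t + 1) ≤ 1 + M := by
  have hM0 : 0 ≤ M := by
    obtain ⟨u⟩ := ‹Nonempty V›
    exact (lasserreStableBound_nonneg _ t ht).trans (hM u)
  refine lasserreStableBound_le_of_forall fun y hy => ?_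
  set s := ∑ v, y {v} with hs
  have h1 : s ^ 2 ≤ ∑ u, ∑ v, y {u, v} :=
    (hy.of_level_le (by omega)).sq_sum_le_sum_sum_pair
  have h2 : ∑ u, ∑ v, y {u, v} ≤ ∑ u, y {u} * (1 + M) :=
    Finset.sum_le_sum fun u _ => (sum_pair_le_mul ht hy u).trans
      (mul_le_mul_of_nonneg_left (by linarith [hM u])
        (hy.apply_nonneg (by rw [card_singleton]; omega)))
  rw [← Finset.sum_mul, ← hs] at h2
  by_contra hc
  push Not at hc
  have hs0 : 0 < s := by linarith
  nlinarith [mul_lt_mul_of_pos_left hc hs0]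

/-- **The registered form**: for every finite nonempty graph, `t ≥ 1` and `M`, if all link complements
satisfy `las_t(G[N̄ u]) ≤ M` then `las_{t+1}(G) ≤ 1 + M`. -/
theorem conditioning_recursion :
    ∀ {V : Type} [Fintype V] [DecidableEq V] [Nonempty V] (G : SimpleGraph V) [DecidableRel G.Adj]
      {t : ℕ}, 1 ≤ t → ∀ {M : ℝ},
      (∀ u : V, lasserreStableBound (G.induce (Gᶜ.neighborSet u)) t ≤ M) →
      lasserreStableBound G (t + 1) ≤ 1 + M := by
  intro V _ _ _ G _ t ht M hM
  exact lasserreStableBound_succ_le_one_add ht hM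

/-- Level 2 in particular: `las₂(G) ≤ 1 + M` whenever `ϑ(G[N̄(u)]) ≤ M` for all `u`.
[folklore; Disproof (f) `lasserreStableBound_two_le_one_add`] -/
theorem lasserreStableBound_two_le_one_add [Nonempty V] {M : ℝ}
    (hM : ∀ u : V, lovaszTheta (G.induce (Gᶜ.neighborSet u)) ≤ M) :
    lasserreStableBound G 2 ≤ 1 + M :=
  lasserreStableBound_succ_le_one_add le_rfl fun u =>
    (lasserreStableBound_one_eq_lovaszTheta _).le.trans (hM u)

end Conditioning

/-! ### (g) `ϑ` under induced subgraphs (after refuter-cdisprove-stmt-PneNP-9815 Disproof (g)) -/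

section ThetaMonotone

variable {V W : Type} [Fintype V] [DecidableEq V] [Fintype W] [DecidableEq W]

/-- **`ϑ` is monotone under induced subgraphs**: `ϑ(G.comap f) ≤ ϑ(G)` for injective `f`
(zero-padding `B ↦ Pᵀ B P` of a feasible matrix, `P_{w,v} = [f w = v]`).
[folklore; Disproof (g) `lovaszTheta_comap_le`] -/
theorem lovaszTheta_comap_le (G : SimpleGraph V) {f : W → V} (hf : Function.Injective f) :
    lovaszTheta (G.comap f) ≤ lovaszTheta G := by
  rw [lovaszTheta]
  refine Real.sSup_le ?_ (lovaszTheta_nonneg G)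
  rintro _ ⟨B, hB, rfl⟩
  -- the zero-padding of `B`
  set P : Matrix W V ℝ := Matrix.of fun w v => if f w = v then 1 else 0 with hP
  set B' : Matrix V V ℝ := Pᴴ * B * P with hB'
  have hentry : ∀ a b : V, B' a b =
      ∑ w, ∑ w', (if f w = a then (1 : ℝ) else 0) * B w w' * (if f w' = b then 1 else 0) := by
    intro a b
    simp only [hB', hP, Matrix.mul_apply, conjTranspose_apply, of_apply, star_trivial,
      Finset.sum_mul]
    rw [Finset.sum_comm]
  have hdiag : ∀ w w' : W, (∑ a : V, (if f w = a then (1 : ℝ) else 0) * B w w' *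
      (if f w' = a then 1 else 0)) = if w = w' then B w w' else 0 := by
    intro w w'
    rw [Finset.sum_eq_single (f w)]
    · by_cases h : w = w'
      · subst h; simp
      · have : f w' ≠ f w := fun h' => h (hf h').symm
        simp [h, this]
    · intro a _ ha; simp [Ne.symm ha]
    · intro h; exact absurd (mem_univ _) h
  have hfeas : IsThetaFeasible G B' := by
    refine ⟨?_, ?_, ?_⟩
    · exact hB.posSemidef.conjTranspose_mul_mul_same P
    · -- trace
      have htr : B'.trace = ∑ w, B w w := by
        simp only [Matrix.trace, Matrix.diag, hentry]
        rw [Finset.sum_comm]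
        refine Finset.sum_congr rfl fun w _ => ?_
        rw [Finset.sum_comm]
        simp only [hdiag]
        simp
      rw [htr]
      have := hB.trace_eq_one
      simpa [Matrix.trace, Matrix.diag] using this
    · intro a b hab
      rw [hentry]
      refine Finset.sum_eq_zero fun w _ => Finset.sum_eq_zero fun w' _ => ?_
      by_cases ha : f w = a
      · by_cases hb : f w' = b
        · have hadj : (G.comap f).Adj w w' := by
            show G.Adj (f w) (f w'); rw [ha, hb]; exact hab
          simp [hB.apply_eq_zero hadj]
        · simp [hb]
      · simp [ha]
  have key : ∀ w w' : W, (∑ a : V, ∑ b : V,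
      (if f w = a then (1 : ℝ) else 0) * B w w' * (if f w' = b then 1 else 0)) = B w w' := by
    intro w w'
    rw [Finset.sum_eq_single (f w)]
    · rw [Finset.sum_eq_single (f w')]
      · simp
      · intro b _ hb; simp [Ne.symm hb]
      · intro h; exact absurd (mem_univ _) h
    · intro a _ ha; simp [Ne.symm ha]
    · intro h; exact absurd (mem_univ _) h
  have hval : entrySum B' = entrySum B := by
    simp only [entrySum, hentry]
    calc (∑ a : V, ∑ b : V, ∑ w : W, ∑ w' : W,
          (if f w = a then (1 : ℝ) else 0) * B w w' * (if f w' = b then 1 else 0))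
        = ∑ a : V, ∑ w : W, ∑ b : V, ∑ w' : W,
          (if f w = a then (1 : ℝ) else 0) * B w w' * (if f w' = b then 1 else 0) :=
          Finset.sum_congr rfl fun a _ => Finset.sum_comm
      _ = ∑ w : W, ∑ a : V, ∑ b : V, ∑ w' : W,
          (if f w = a then (1 : ℝ) else 0) * B w w' * (if f w' = b then 1 else 0) :=
          Finset.sum_comm
      _ = ∑ w : W, ∑ a : V, ∑ w' : W, ∑ b : V,
          (if f w = a then (1 : ℝ) else 0) * B w w' * (if f w' = b then 1 else 0) :=
          Finset.sum_congr rfl fun w _ => Finset.sum_congr rfl fun a _ => Finset.sum_comm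
      _ = ∑ w : W, ∑ w' : W, ∑ a : V, ∑ b : V,
          (if f w = a then (1 : ℝ) else 0) * B w w' * (if f w' = b then 1 else 0) :=
          Finset.sum_congr rfl fun w _ => Finset.sum_comm
      _ = ∑ w : W, ∑ w' : W, B w w' :=
          Finset.sum_congr rfl fun w _ => Finset.sum_congr rfl fun w' _ => key w w'
  rw [← hval]
  exact le_csSup (bddAbove_thetaValues G) ⟨B', hfeas, rfl⟩

/-- `ϑ` is monotone along graph embeddings: `H ↪g G` gives `ϑ(H) ≤ ϑ(G)` (an embedding is an
induced subgraph: `H = G.comap φ`). [folklore] -/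
theorem lovaszTheta_le_of_embedding {G : SimpleGraph V} {H : SimpleGraph W} (φ : H ↪g G) :
    lovaszTheta H ≤ lovaszTheta G := by
  have hH : H = G.comap φ := by
    ext a b
    exact (φ.map_adj_iff).symm
  rw [hH]
  exact lovaszTheta_comap_le G φ.injective

/-- `ϑ` is invariant under graph isomorphism. [folklore] -/
theorem lovaszTheta_eq_of_iso {G : SimpleGraph V} {H : SimpleGraph W} (φ : H ≃g G) :
    lovaszTheta H = lovaszTheta G :=
  le_antisymm (lovaszTheta_le_of_embedding φ.toEmbedding)
    (lovaszTheta_le_of_embedding φ.symm.toEmbedding)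

omit [Fintype V] [DecidableEq V] [Fintype W] [DecidableEq W] in
/-- `comap` along an injection commutes with complement. [folklore; Disproof (g) `compl_comap_eq`] -/
theorem compl_comap_eq (G : SimpleGraph V) {f : W → V} (hf : Function.Injective f) :
    (G.comap f)ᶜ = Gᶜ.comap f := by
  ext a b
  simp only [SimpleGraph.compl_adj, SimpleGraph.comap_adj, hf.ne_iff]

omit [Fintype V] [DecidableEq V] in
/-- Induced subgraphs commute with complement: `(G.induce s)ᶜ = Gᶜ.induce s`. [folklore] -/
theorem compl_induce_eq (G : SimpleGraph V) (s : Set V) : (G.induce s)ᶜ = Gᶜ.induce s :=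
  compl_comap_eq G Subtype.val_injective

/-- `ϑ` is monotone under inclusion of inducing sets: `s ⊆ s'` gives `ϑ(G[s]) ≤ ϑ(G[s'])`.
[folklore] -/
theorem lovaszTheta_induce_mono (G : SimpleGraph V) {s s' : Set V} [DecidablePred (· ∈ s)]
    [DecidablePred (· ∈ s')] (h : s ⊆ s') :
    lovaszTheta (G.induce s) ≤ lovaszTheta (G.induce s') :=
  lovaszTheta_le_of_embedding (SimpleGraph.induceHomOfLE G h)

/-- `ϑ(G[s])` only depends on the set `s` (transport along a set equality). [folklore] -/
theorem lovaszTheta_induce_congr (G : SimpleGraph V) {s s' : Set V} [DecidablePred (· ∈ s)]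
    [DecidablePred (· ∈ s')] (h : s = s') :
    lovaszTheta (G.induce s) = lovaszTheta (G.induce s') :=
  le_antisymm (lovaszTheta_induce_mono G h.le) (lovaszTheta_induce_mono G h.ge)

/-- `ϑ` of the subgraph induced on all vertices is `ϑ(G)`. [folklore] -/
theorem lovaszTheta_induce_univ (G : SimpleGraph V) :
    lovaszTheta (G.induce (Set.univ : Set V)) = lovaszTheta G :=
  lovaszTheta_eq_of_iso (SimpleGraph.induceUnivIso G)

/-- **Lovász's uncertainty principle on a common part.** If `X ⊆ A` and `X ⊆ B` then
`|X| ≤ ϑ(G[A]) · ϑ(Gᶜ[B])`: Lovász Cor. 2 on `G[X]` (`|X| ≤ ϑ(G[X]) ϑ(G[X]ᶜ)`, tree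
`card_le_lovaszTheta_mul_lovaszTheta_compl`) and monotonicity of `ϑ` under induced subgraphs. With
`A = N̄(S)`, `B = N(T)` this is why a conditioning certificate cannot be small on both sides.
[folklore; Disproof (g) `card_inter_le_linkTheta_mul`, generalised] -/
theorem card_le_linkTheta_mul (G : SimpleGraph V) {X A B : Set V} [DecidablePred (· ∈ X)]
    [DecidablePred (· ∈ A)] [DecidablePred (· ∈ B)] (hA : X ⊆ A) (hB : X ⊆ B) :
    (Fintype.card X : ℝ) ≤ lovaszTheta (G.induce A) * lovaszTheta (Gᶜ.induce B) := by
  have hθ1 : 0 ≤ lovaszTheta (G.induce A) := lovaszTheta_nonneg _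
  have hθ2 : 0 ≤ lovaszTheta (Gᶜ.induce B) := lovaszTheta_nonneg _
  rcases isEmpty_or_nonempty X with hXe | hXne
  · rw [Fintype.card_eq_zero, Nat.cast_zero]; positivity
  · have hLov := card_le_lovaszTheta_mul_lovaszTheta_compl (G.induce X)
    have h1 : lovaszTheta (G.induce X) ≤ lovaszTheta (G.induce A) :=
      lovaszTheta_induce_mono G hA
    have h2 : lovaszTheta (G.induce X)ᶜ ≤ lovaszTheta (Gᶜ.induce B) := by
      rw [compl_induce_eq]
      exact lovaszTheta_induce_mono Gᶜ hB
    exact hLov.trans (mul_le_mul h1 h2 (lovaszTheta_nonneg _) hθ1)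

end ThetaMonotone

end Summit.PneNP.PneNP.Theorems.SosUncertainty
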